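import Summits.Ventures.PercRepro.Night2LocalR1ColD
import Summits.Ventures.PercRepro.Night2LocalFourTwo

/-!
# PercRepro — the `(5, 3)` diagonal shadow form for every finite matroid without a parallel pair (night-2, gen 10)

`shadowHall_five_three_of_simple` (`Night2LocalR1ColD`) needs rank exactly `5`.  Here: rank `< 5` has no bottom
set (`Uq_eq_empty_of_eRank_lt`), rank `≥ 5` truncates to a simple matroid of rank `5` (`shadowHall_of_truncate`,
the truncation keeps the rank of every pair), and loops are removed one at a time (`shadowHall_of_delete_loop`,
induction on `|E|` as in `shadowHall_four_two`).  Result: **`shadowHall_five_three_of_no_parallel`** — the `(5, 3)`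
instance of the lane's statement of record `ShadowC025` for every finite matroid in which any two distinct
nonloops have rank `2` (parallel classes are the one remaining gap at `(5, 3)`).
-/

open scoped Matroid

namespace PercRepro.Shadow

open Finset PerFlat ThmH

variable {α : Type} [DecidableEq α]

omit [DecidableEq α] in
/-- Deleting an element outside `X` does not change the rank of `X`. -/
theorem rkN_delete_of_notMem {M : Matroid α} [M.Finite] {ℓ : α} {X : Finset α} (hX : X ⊆ gr M)
    (hℓ : ℓ ∉ X) : rkN (M ＼ ({ℓ} : Set α)) X = rkN M X := by
  unfold rkN
  rw [Matroid.delete_eq_restrict, Matroid.restrict_eRk_eq]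
  rw [Set.subset_sdiff, Set.disjoint_singleton_right, Finset.mem_coe]
  exact ⟨by rw [← coe_gr]; exact_mod_cast hX, hℓ⟩

/-- **The `(5, 3)` shadow form for every simple finite matroid** (any rank): rank `< 5` has no bottom set, rank
`≥ 5` truncates to a simple matroid of rank `5`. -/
theorem shadowHall_five_three_of_simple' (M : Matroid α) [M.Finite]
    (hsimple : ∀ e ∈ gr M, ∀ f ∈ gr M, e ≠ f → rkN M {e, f} = 2) :
    ShadowHall M 5 3 (((3 : ℕ) + 2 : ℚ) / ((3 : ℕ) + 1 : ℚ)) := by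
  by_cases hlt : M.eRank < ((5 : ℕ) : ℕ∞)
  · exact shadowHall_of_Uq_empty (Uq_eq_empty_of_eRank_lt hlt)
  · have hge : ((5 : ℕ) : ℕ∞) ≤ M.eRank := not_lt.1 hlt
    apply shadowHall_of_truncate M (by norm_num : (3 : ℕ) < 5)
    apply shadowHall_five_three_of_simple
    · intro e he f hf hef
      rw [gr_truncate] at he hf
      have h2 : M.eRk (({e, f} : Finset α) : Set α) = ((2 : ℕ) : ℕ∞) := by
        rw [eRk_eq_rkN, hsimple e he f hf hef]
      unfold rkN
      rw [PercRepro.Matroid.truncate_eRk, h2, min_eq_left (by exact_mod_cast (by norm_num : (2 : ℕ) ≤ 5))]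
      rfl
    · rw [gr_truncate, PercRepro.Matroid.truncate_eRk_eq_of_ge]
      rw [coe_gr, ← Matroid.eRank_def]
      exact hge

/-- **The `(5, 3)` diagonal shadow form for every finite matroid without a parallel pair**: if any two distinct
nonloops have rank `2` (loops allowed, any rank), then every sub-family `𝒜` of the bottom sets `Uq M 5 3` has at
least `(5/4)·#𝒜` rank-`4` sets above it. -/
theorem shadowHall_five_three_of_no_parallel (M : Matroid α) [M.Finite]
    (hnp : ∀ e ∈ gr M, ∀ f ∈ gr M, M.Indep {e} → M.Indep {f} → e ≠ f → rkN M {e, f} = 2) :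
    ShadowHall M 5 3 (((3 : ℕ) + 2 : ℚ) / ((3 : ℕ) + 1 : ℚ)) := by
  classical
  suffices h : ∀ (n : ℕ) (N : Matroid α) [N.Finite], (gr N).card ≤ n →
      (∀ e ∈ gr N, ∀ f ∈ gr N, N.Indep {e} → N.Indep {f} → e ≠ f → rkN N {e, f} = 2) →
      ShadowHall N 5 3 (((3 : ℕ) + 2 : ℚ) / ((3 : ℕ) + 1 : ℚ)) from h (gr M).card M le_rfl hnp
  intro n
  induction n using Nat.strong_induction_on with
  | _ n ihn =>
    intro N _ hn hN
    by_cases hL : ∃ ℓ ∈ N.E, ¬ N.Indep {ℓ}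
    · obtain ⟨ℓ, hℓ, hl⟩ := hL
      have hℓg : ℓ ∈ gr N := by rw [← Finset.mem_coe, coe_gr]; exact hℓ
      have hcard : (gr (N ＼ ({ℓ} : Set α))).card < n := by
        rw [gr_delete, Finset.card_erase_of_mem hℓg]
        have : 0 < (gr N).card := Finset.card_pos.2 ⟨ℓ, hℓg⟩
        omega
      refine shadowHall_of_delete_loop hℓ hl (by norm_num) (ihn _ hcard (N ＼ ({ℓ} : Set α)) le_rfl ?_)
      intro e he f hf hei hfi hef
      rw [gr_delete, Finset.mem_erase] at he hf
      rw [Matroid.delete_indep_iff] at hei hfi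
      have hpair : ({e, f} : Finset α) ⊆ gr N := by
        intro g hg
        rw [Finset.mem_insert, Finset.mem_singleton] at hg
        rcases hg with rfl | rfl
        · exact he.2
        · exact hf.2
      have hℓp : ℓ ∉ ({e, f} : Finset α) := by
        rw [Finset.mem_insert, Finset.mem_singleton]
        rintro (rfl | rfl)
        · exact he.1 rfl
        · exact hf.1 rfl
      rw [rkN_delete_of_notMem hpair hℓp]
      exact hN e he.2 f hf.2 hei.1 hfi.1 hef
    · apply shadowHall_five_three_of_simple' N
      intro e he f hf hef
      exact hN e he f hf (indep_singleton_of_no_loop hL e he) (indep_singleton_of_no_loop hL f hf) hef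

/-- The same in the `phiK` spelling of `ShadowC025`: `ShadowHall M 5 3 (phiK 5 3)` for every finite matroid
without a parallel pair. -/
theorem shadowHall_five_three_of_no_parallel_phiK (M : Matroid α) [M.Finite]
    (hnp : ∀ e ∈ gr M, ∀ f ∈ gr M, M.Indep {e} → M.Indep {f} → e ≠ f → rkN M {e, f} = 2) :
    ShadowHall M 5 3 (phiK 5 3) := by
  have hphi : phiK 5 3 = ((3 : ℕ) + 2 : ℚ) / ((3 : ℕ) + 1 : ℚ) := by
    unfold phiK
    rw [show Finset.Ioo 3 5 = {4} by decide, Finset.sum_singleton,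
      show Nat.choose (5 + 3) 4 = 70 by decide, show Nat.choose (5 + 3) 5 = 56 by decide]
    norm_num
  rw [hphi]
  exact shadowHall_five_three_of_no_parallel M hnp

end PercRepro.Shadow
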